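import Summits.BirchSwinnertonDyer.BirchSwinnertonDyer.Theorems.KolyvaginRoadThreeMethod2LocalH0
import Summits.BirchSwinnertonDyer.Rank1Residual.GaloisImage.LocalH1UnramifiedSquare
import Literature.NumberTheory.EllipticCurves.HeegnerPointsKolyvaginPairing
import HarnessLib

/-!
# Route `KolyvaginRoadThree`, deciding crux `ZhangSharpFrameAtThreeHL` (item stmt-BirchSwinnertonDyer-19574):
# `#H¹(K_v, E[3]) = 81` at a place whose decomposition group fixes `E[3]` — the input `9 < #H¹(K_λ, E[3])` of the
# unsigned jump (J) at a Kolyvagin prime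
# (cell `bsd-stepL`, ACCEL seat `bsd-stepL-koly3b` g5; `--supports stmt-BirchSwinnertonDyer-19574`, helper; part XV of the
# `KolyvaginRoadThreeZhangSupply*` series; the binder `hw` of part XIV `hjump_of_lagrangian`)

HONEST FRAMING. Theorems only; 0 definitions, 0 named facts, 0 `sorry`; closes nothing (T7). PARTITION: O2@3 (B10) × A1 ×
crux 19574 × the S2-ENGINE's (Supply) binder — proves-glue.

WHAT. For `E = W/ℚ`, `K` a number field and a finite place `v ∤ 3` of `K` such that the decomposition group `D_𝔓` of
some prime `𝔓 ∣ v` of `ℤ̄_K` acts trivially on `E[3](K̄)` (at a Kolyvagin prime `λ = (ℓ)`: inertia acts trivially by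
good reduction, the Frobenius by `Frob_λ = Frob_ℓ² = 1` on `E[3]` — Gross (3.3), Cayley–Hamilton with `3 ∣ a_ℓ`,
`3 ∣ ℓ + 1`), the local Galois group `Γ_{K_v}` fixes `E[3]` (its restrictions lie in `D_𝔓`, Neukirch II (9.6) easy
inclusion, tree `resGalOfEmb_mem_decompositionSubgroup`; all `D_𝔓`, `𝔓 ∣ v`, are conjugate), so `#E(K_v)[3] = 9`
(`natCard_invariants_torsion_restrictField`) and `#H¹(K_v, E[3]) = #E(K_v)[3]² = 81` (n1011 `LocalH1UnramifiedSquare`: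
Milne I Thm. 2.8). `natCard_galoisCohomology_one_toLocal_eq_of_decomposition_le_torsionFixing`,
`nine_lt_natCard_galoisCohomology_one_toLocal`. What remains for the binder `hw` at a Zhang–Kolyvagin prime: the inclusion
`D_𝔓 ≤ Γ_{K(E[3])}` (zhang3-p1 g9's announced Cayley–Hamilton lemma; for Gross's `IsKolyvaginPrime` the tree has the
Frobenius in `torsionFixing` via `exists_frobeniusLift_of_isKolyvaginPrime` and `inertia_le_torsionFixing`).

References: [cite: MilneADT2006, Ch. I, Thm. 2.8, Lemma 2.9] [cite: NeukirchANT1999, Ch. II §9 (9.6)] [cite: GrossLMS1991,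
§3 (3.3)] [cite: WZhang2014, Notations (xii)].
-/

noncomputable section

open scoped Classical Pointwise

namespace Summit.BirchSwinnertonDyer.Rank1Residual.X11b.Three.Koly.ZhangSupply

open CategoryTheory WeierstrassCurve Field Function NumberField IsDedekindDomain
open Literature.NumberTheory.EllipticCurves Literature.NumberTheory.GaloisRepresentations
open Summit.BirchSwinnertonDyer.Rank1Residual.GaloisImage
  Summit.BirchSwinnertonDyer.Rank1Residual.GaloisImage.LocalH1UnramifiedSquare

variable (W : WeierstrassCurve ℚ) (K : Type) [Field K] [NumberField K] [W.IsElliptic]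

/-- **If some decomposition group above `v` fixes `E[3]`, every `3`-torsion point is `K_v`-rational**: the invariants of
`Γ_{K_v}` on `E[3](K̄)` (restricted module) are everything, so they number `9`. [cite: NeukirchANT1999, Ch. II §9 (9.6)] -/
theorem natCard_invariants_eq_nine_of_decomposition_le_torsionFixing (v : HeightOneSpectrum (𝓞 K))
    (hD : ∀ 𝔓 ∈ v.primesAbove,
      𝔓.decompositionSubgroup (absoluteGaloisGroup K) ≤ torsionFixing (W.baseChange K) ((3 ^ 1 : ℕ) : ℤ)) :
    Nat.card (GaloisRep.restrictField (v.adicCompletion K)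
      ((W.baseChange K).torsionGaloisModule ((3 ^ 1 : ℕ) : ℤ))).toTopRep.ρ.invariants = 9 := by
  -- the prime of `ℤ̄_K` cut out by the chosen embedding `K̄ → K̄_v`
  set ι₀ := closureEmb (K := K) (v.adicCompletion K) with hι₀
  obtain ⟨𝔐, h𝔐⟩ := v.localPrimesAbove_nonempty
  set 𝔓 := v.primeBelow ι₀ 𝔐 with h𝔓def
  have h𝔓 : 𝔓 ∈ v.primesAbove := HeightOneSpectrum.primeBelow_mem_primesAbove h𝔐
  set H := (GaloisRep.restrictField (v.adicCompletion K)
      ((W.baseChange K).torsionGaloisModule ((3 ^ 1 : ℕ) : ℤ))).toTopRep.ρ.invariants with hHdef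
  -- every point is invariant
  have htop : ∀ Q : geomTorsion (W.baseChange K) ((3 ^ 1 : ℕ) : ℤ), Q ∈ H := by
    intro Q
    refine (ContRepresentation.mem_invariants _).mpr fun σ ↦ ?_
    have hσ : resGal (K := K) (v.adicCompletion K) σ ∈ 𝔓.decompositionSubgroup (absoluteGaloisGroup K) := by
      rw [resGal_eq]; exact resGalOfEmb_mem_decompositionSubgroup ι₀ h𝔐 σ
    have hfix := smul_eq_of_mem_torsionFixing (W.baseChange K) ((3 ^ 1 : ℕ) : ℤ) (hD 𝔓 h𝔓 hσ) Q
    change absGaloisRestrict K (v.adicCompletion K) σ • Q = Q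
    rwa [← resGal_eq_absGaloisRestrict]
  have h9 : Nat.card (geomTorsion (W.baseChange K) ((3 ^ 1 : ℕ) : ℤ)) = 9 := by
    rw [natCard_geomTorsion (W.baseChange K) ((3 ^ 1 : ℕ) : ℤ) (by norm_num)]
    norm_num
  have hHtop : H.toAddSubgroup = ⊤ := by
    rw [eq_top_iff]
    intro Q _
    exact htop Q
  change Nat.card H.toAddSubgroup = 9
  rw [hHtop, AddSubgroup.card_top, h9]

/-- **`#H¹(K_v, E[3]) = 81`** at a finite place `v ∤ 3` some decomposition group above which fixes `E[3]`: Milne I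
Thm. 2.8 (`#H¹ = #E(K_v)[3]²`, n1011 `natCard_galoisCohomology_one_primeTorsion_adicCompletion_eq_sq_of_not_mem`) with
`#E(K_v)[3] = 9`. [cite: MilneADT2006, Ch. I, Thm. 2.8] [cite: NeukirchANT1999, Ch. II §9 (9.6)] -/
theorem natCard_galoisCohomology_one_toLocal_eq_of_decomposition_le_torsionFixing (v : HeightOneSpectrum (𝓞 K))
    (h3v : ((3 : ℕ) : 𝓞 K) ∉ v.asIdeal)
    (hD : ∀ 𝔓 ∈ v.primesAbove,
      𝔓.decompositionSubgroup (absoluteGaloisGroup K) ≤ torsionFixing (W.baseChange K) ((3 ^ 1 : ℕ) : ℤ)) :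
    Nat.card (galoisCohomology (((W.baseChange K).torsionGaloisModule ((3 ^ 1 : ℕ) : ℤ)).toLocal (Sum.inr v)) 1) = 81 := by
  haveI : Fact (3 : ℕ).Prime := ⟨Nat.prime_three⟩
  haveI : CharZero (v.adicCompletion K) := charZero_of_injective_algebraMap (algebraMap K _).injective
  have h1 := natCard_galoisCohomology_one_primeTorsion_adicCompletion_eq_sq_of_not_mem (W.baseChange K) v 3 h3v
  have h0 := natCard_invariants_torsion_restrictField (W.baseChange K) (v.adicCompletion K) (n := 3) (by norm_num)
  have h9 := natCard_invariants_eq_nine_of_decomposition_le_torsionFixing W K v hD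
  change Nat.card (galoisCohomology
    (GaloisRep.restrictField (v.adicCompletion K) ((W.baseChange K).torsionGaloisModule ((3 : ℕ) : ℤ))) 1) = 81
  change Nat.card (GaloisRep.restrictField (v.adicCompletion K)
      ((W.baseChange K).torsionGaloisModule ((3 : ℕ) : ℤ))).toTopRep.ρ.invariants = 9 at h9
  rw [h1, ← h0, h9]
  norm_num

/-- **`9 < #H¹(K_v, E[3])`** — the binder `hw` of `hjump_of_lagrangian` (`(3 ^ 1) ^ 2 < #H¹(K_λ, E[3])`) at a finite
place `v ∤ 3` some decomposition group above which fixes `E[3]` (e.g. a Kolyvagin prime).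
[cite: MilneADT2006, Ch. I, Thm. 2.8] [cite: GrossLMS1991, §3 (3.3)] -/
theorem nine_lt_natCard_galoisCohomology_one_toLocal (v : HeightOneSpectrum (𝓞 K))
    (h3v : ((3 : ℕ) : 𝓞 K) ∉ v.asIdeal)
    (hD : ∀ 𝔓 ∈ v.primesAbove,
      𝔓.decompositionSubgroup (absoluteGaloisGroup K) ≤ torsionFixing (W.baseChange K) ((3 ^ 1 : ℕ) : ℤ)) :
    (3 ^ 1 : ℕ) ^ 2 <
      Nat.card (galoisCohomology (((W.baseChange K).torsionGaloisModule ((3 ^ 1 : ℕ) : ℤ)).toLocal (Sum.inr v)) 1) := by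
  rw [natCard_galoisCohomology_one_toLocal_eq_of_decomposition_le_torsionFixing W K v h3v hD]
  norm_num

end Summit.BirchSwinnertonDyer.Rank1Residual.X11b.Three.Koly.ZhangSupply

end
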